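import Summits.CriticalPhenomena.PercolationContinuityZ3.Theorems.Transplant.SiteGibbsSampler
import HarnessLib

/-!
# SITE percolation: covariances along the site two-cluster Gibbs sampler — the one-step covariance decomposition and the reduction
# of a conditional covariance sign to the sign of the averaged one-step ("within") covariances
# (WP1 of P1-SITE-Z3 §12/§15, part 2; site twin of `Literature/Probability/Percolation/TwoClusterGibbsCovariance.lean` §Sums)

builds on p205010 (kernel theorem, internal audit signed; external expert review pending).

Sum level, site clusters `C_S = SiteBHK.setC Γ univ S ζ`, site chain of `SiteGibbsSampler` (`halfT/halfS/gibbsE/regenWeight`).  For functions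
`φ, h` of `C_S`: `condS` (`E[φ(C_S) | C_T = B]`), `gibbsT` (the one-step operator `𝑇` on functions of `C_S`), `condCov`, the averaged within
covariance `withinD`, the denominator-free conditional covariance `covDs`; monotonicity / positivity / contraction of `𝑇`; the exact
ONE-STEP DECOMPOSITION `covDs(φ, h) = P(D)·withinD(φ) + covDs(𝑇φ, h)` and its telescoped form; and the REDUCTION THEOREM
**`covDs_nonneg_of_withinD_nonneg`**: if the regeneration weight is positive and `withinD(g) ≥ 0` for every monotone `g ≥ 0`, then
`covDs(f, h) ≥ 0` for every monotone `f` (any test function `h`).  OURS for the site model; verbatim the bond algebra.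
Definitions + proofs (`--supports stmt-CriticalPhenomena-4575 --as helper`); no named facts, no sorries.
[cite: VandenbergHaggstromKahn2005, §2.1 pp. 9–13 (Lemmas 2.3–2.4, the chain, Claim 2.5, Remark 2.8)]
-/

noncomputable section

namespace Summit.CriticalPhenomena.PercolationContinuityZ3.Theorems.Transplant

namespace SiteGibbs

open MeasureTheory Set
open Literature.Probability.Percolation
open Literature.Probability.Percolation.BHK2006 (weight weight_nonneg ind_le_one)
open Literature.Probability.Percolation.DecisionTree (ind ind_of_mem ind_of_not_mem ind_nonneg)
open SiteBHK (setC deadOf)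
open scoped Classical

variable {V : Type*} [Fintype V] {Γ : SimpleGraph V}

/-! ### The half-step and one-step operators on functions of `C_S` -/

variable (Γ) in
/-- **`E[φ(C_S) | C_T = B]`** (the `S`-half-step of the site chain applied to a function of `C_S`). [cite: VandenbergHaggstromKahn2005, §2.1 Lemma 2.4 (p. 10), p. 11] -/
def condS (w : V → ℝ) (S T : Set V) (φ : Set V → ℝ) (B : Set V) : ℝ :=
  ∑ η, weight w η * φ (halfS Γ S T B η)

variable (Γ) in
/-- **The one-step operator on functions of `C_S`**: `(𝑇φ)(C) = E[ E[φ(C_S') | C_T'] | C_S = C]`. [cite: VandenbergHaggstromKahn2005, §2.1 pp. 10–11] -/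
def gibbsT (w : V → ℝ) (S T : Set V) (φ : Set V → ℝ) (A : Set V) : ℝ :=
  ∑ η, weight w η * condS Γ w S T φ (halfT Γ S T A η)

variable (Γ) in
/-- **Conditional covariance given `C_T = B`** of two functions of `C_S`. [cite: VandenbergHaggstromKahn2005, §2.1 Lemma 2.4 (p. 10)] -/
def condCov (w : V → ℝ) (S T : Set V) (φ h : Set V → ℝ) (B : Set V) : ℝ :=
  condS Γ w S T (fun A => φ A * h A) B - condS Γ w S T φ B * condS Γ w S T h B

variable (Γ) in
/-- **The averaged one-step ("within") covariance** `R(φ) = E[ Cov(φ(C_S), h(C_S) | C_T) 1_D ]` (denominator-free). [cite: VandenbergHaggstromKahn2005, §2.1 pp. 10–11] -/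
def withinD (w : V → ℝ) (S T : Set V) (D : Set (Set V)) (φ h : Set V → ℝ) : ℝ :=
  ∑ ω, weight w ω * (condCov Γ w S T φ h (setC Γ Finset.univ T ω) * ind D ω)

variable (Γ) in
/-- **Denominator-free conditional covariance on `D`** of two functions of `C_S`:
`cov_D(φ, h) = P(D)·E[φ(C_S) h(C_S) 1_D] − E[φ(C_S) 1_D]·E[h(C_S) 1_D]`. [cite: VandenbergHaggstromKahn2005, Thm. 1.5 eq. (9) (p. 7)] -/
def covDs (w : V → ℝ) (S : Set V) (D : Set (Set V)) (φ h : Set V → ℝ) : ℝ :=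
  (∑ ω, weight w ω * ind D ω) * (∑ ω, weight w ω * (φ (setC Γ Finset.univ S ω) * h (setC Γ Finset.univ S ω) * ind D ω)) -
    (∑ ω, weight w ω * (φ (setC Γ Finset.univ S ω) * ind D ω)) *
      (∑ ω, weight w ω * (h (setC Γ Finset.univ S ω) * ind D ω))

/-- `𝑇` is the chain's one-step operator `gibbsE` restricted to functions of the first coordinate. [folklore] -/
theorem gibbsE_comp_fst (w : V → ℝ) (S T : Set V) (φ : Set V → ℝ) :
    gibbsE Γ w S T (φ ∘ Prod.fst) = gibbsT Γ w S T φ ∘ Prod.fst := by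
  funext x
  rfl

/-- Iterates: `gibbsEⁿ (φ ∘ fst) = (𝑇ⁿ φ) ∘ fst`. [folklore] -/
theorem gibbsE_iterate_comp_fst (w : V → ℝ) (S T : Set V) (n : ℕ) (φ : Set V → ℝ) :
    (gibbsE Γ w S T)^[n] (φ ∘ Prod.fst) = (gibbsT Γ w S T)^[n] φ ∘ Prod.fst := by
  induction n generalizing φ with
  | zero => rfl
  | succ n ih =>
    rw [Function.iterate_succ_apply, Function.iterate_succ_apply, gibbsE_comp_fst, ih]

/-! ### Monotonicity, positivity and contraction of the operators -/

/-- `E[φ(C_S) | C_T = B]` is decreasing in `B` for increasing `φ` (Remark 2.8). [cite: VandenbergHaggstromKahn2005, §2.1 Remark 2.8 (p. 12)] -/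
theorem condS_antitone {w : V → ℝ} (hw0 : ∀ u, 0 ≤ w u) (hw1 : ∀ u, w u ≤ 1) (S T : Set V)
    {φ : Set V → ℝ} (hφ : Monotone φ) : Antitone (condS Γ w S T φ) := by
  intro B B' hBB'
  exact Finset.sum_le_sum fun η _ => mul_le_mul_of_nonneg_left
    (hφ (halfS_mono S T hBB' le_rfl)) (weight_nonneg hw0 hw1 η)

/-- `E[φ(C_S) | C_T = B] ≥ 0` for `φ ≥ 0`. [folklore] -/
theorem condS_nonneg {w : V → ℝ} (hw0 : ∀ u, 0 ≤ w u) (hw1 : ∀ u, w u ≤ 1) (S T : Set V)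
    {φ : Set V → ℝ} (hφ0 : ∀ A, 0 ≤ φ A) (B : Set V) : 0 ≤ condS Γ w S T φ B :=
  Finset.sum_nonneg fun η _ => mul_nonneg (weight_nonneg hw0 hw1 η) (hφ0 _)

/-- **`𝑇` preserves monotonicity.** [cite: VandenbergHaggstromKahn2005, §2.1 Remark 2.8 (p. 12)] -/
theorem gibbsT_mono {w : V → ℝ} (hw0 : ∀ u, 0 ≤ w u) (hw1 : ∀ u, w u ≤ 1) (S T : Set V)
    {φ : Set V → ℝ} (hφ : Monotone φ) : Monotone (gibbsT Γ w S T φ) := by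
  intro A A' hAA'
  exact Finset.sum_le_sum fun η _ => mul_le_mul_of_nonneg_left
    (condS_antitone hw0 hw1 S T hφ (halfT_mono S T hAA' le_rfl)) (weight_nonneg hw0 hw1 η)

/-- `𝑇` preserves nonnegativity. [folklore] -/
theorem gibbsT_nonneg {w : V → ℝ} (hw0 : ∀ u, 0 ≤ w u) (hw1 : ∀ u, w u ≤ 1) (S T : Set V)
    {φ : Set V → ℝ} (hφ0 : ∀ A, 0 ≤ φ A) (A : Set V) : 0 ≤ gibbsT Γ w S T φ A :=
  Finset.sum_nonneg fun η _ => mul_nonneg (weight_nonneg hw0 hw1 η) (condS_nonneg hw0 hw1 S T hφ0 _)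

/-- The iterates `𝑇ⁿ φ` of a monotone nonnegative `φ` are monotone and nonnegative. [cite: VandenbergHaggstromKahn2005, §2.1 Remark 2.8 (p. 12)] -/
theorem gibbsT_iterate_mono_nonneg {w : V → ℝ} (hw0 : ∀ u, 0 ≤ w u) (hw1 : ∀ u, w u ≤ 1)
    (S T : Set V) {φ : Set V → ℝ} (hφ : Monotone φ) (hφ0 : ∀ A, 0 ≤ φ A) (n : ℕ) :
    Monotone ((gibbsT Γ w S T)^[n] φ) ∧ ∀ A, 0 ≤ (gibbsT Γ w S T)^[n] φ A := by
  induction n with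
  | zero => exact ⟨hφ, hφ0⟩
  | succ n ih =>
    rw [Function.iterate_succ_apply']
    exact ⟨gibbsT_mono hw0 hw1 S T ih.1, gibbsT_nonneg hw0 hw1 S T ih.2⟩

/-- **Regeneration contraction for `𝑇`**: `osc(𝑇ⁿ φ) ≤ (1 − ε)ⁿ osc(φ)`. [folklore] (Doeblin coupling) -/
theorem gibbsT_iterate_sub_le {w : V → ℝ} (hw0 : ∀ u, 0 ≤ w u) (hw1 : ∀ u, w u ≤ 1)
    (hm : ∑ ω, weight w ω = 1) (S T : Set V) (n : ℕ) {φ : Set V → ℝ} {c : ℝ}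
    (hφ : ∀ A A', φ A - φ A' ≤ c) (A A' : Set V) :
    (gibbsT Γ w S T)^[n] φ A - (gibbsT Γ w S T)^[n] φ A' ≤ (1 - regenWeight w T) ^ n * c := by
  have h := gibbsE_iterate_sub_le (Γ := Γ) hw0 hw1 hm S T n (Φ := φ ∘ Prod.fst) (c := c)
    (fun x y => hφ x.1 y.1) (A, ∅) (A', ∅)
  rwa [gibbsE_iterate_comp_fst] at h

/-! ### The one-step covariance decomposition and its telescoped form -/

/-- **One-step covariance decomposition along the site chain**: `cov_D(φ, h) = P(D) · R(φ) + cov_D(𝑇φ, h)`, exactly.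
[cite: VandenbergHaggstromKahn2005, §2.1 Lemma 2.4 (p. 10) and pp. 10–11 — corollary, derived here for the site model] -/
theorem covDs_eq_withinD_add (w : V → ℝ) (hm : ∑ ω, weight w ω = 1) (S T : Set V)
    {D : Set (Set V)} (hD : ∀ ω, ω ∈ D ↔ ∀ s ∈ S, ∀ t ∈ T, t ∉ siteCluster Γ ω s) (φ h : Set V → ℝ) :
    covDs Γ w S D φ h = (∑ ω, weight w ω * ind D ω) * withinD Γ w S T D φ h + covDs Γ w S D (gibbsT Γ w S T φ) h := by
  have e1 : ∑ ω, weight w ω * (φ (setC Γ Finset.univ S ω) * h (setC Γ Finset.univ S ω) * ind D ω) =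
      ∑ ω, weight w ω * (condS Γ w S T (fun A => φ A * h A) (setC Γ Finset.univ T ω) * ind D ω) :=
    set_sum_cond_cluster' w hm S T (fun A _ => φ A * h A) hD
  have e2 : ∑ ω, weight w ω * (φ (setC Γ Finset.univ S ω) * ind D ω) =
      ∑ ω, weight w ω * (condS Γ w S T φ (setC Γ Finset.univ T ω) * ind D ω) :=
    set_sum_cond_cluster' w hm S T (fun A _ => φ A) hD
  have e3 : ∑ ω, weight w ω * (h (setC Γ Finset.univ S ω) * ind D ω) =
      ∑ ω, weight w ω * (condS Γ w S T h (setC Γ Finset.univ T ω) * ind D ω) :=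
    set_sum_cond_cluster' w hm S T (fun A _ => h A) hD
  have e4 : ∑ ω, weight w ω * (gibbsT Γ w S T φ (setC Γ Finset.univ S ω) * h (setC Γ Finset.univ S ω) * ind D ω) =
      ∑ ω, weight w ω * (condS Γ w S T φ (setC Γ Finset.univ T ω) * h (setC Γ Finset.univ S ω) * ind D ω) := by
    rw [set_sum_cond_cluster w hm S T (fun A B => condS Γ w S T φ B * h A) hD]
    refine Finset.sum_congr rfl fun ω _ => ?_
    simp only [gibbsT, halfT, Finset.sum_mul, mul_assoc]
  have e5 : ∑ ω, weight w ω * (condS Γ w S T φ (setC Γ Finset.univ T ω) * h (setC Γ Finset.univ S ω) * ind D ω) =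
      ∑ ω, weight w ω * (condS Γ w S T φ (setC Γ Finset.univ T ω) * condS Γ w S T h (setC Γ Finset.univ T ω) * ind D ω) := by
    rw [set_sum_cond_cluster' w hm S T (fun A B => condS Γ w S T φ B * h A) hD]
    refine Finset.sum_congr rfl fun ω _ => ?_
    congr 1
    congr 1
    have hc : condS Γ w S T h (setC Γ Finset.univ T ω) = ∑ η, weight w η * h (halfS Γ S T (setC Γ Finset.univ T ω) η) := rfl
    rw [hc, Finset.mul_sum]
    refine Finset.sum_congr rfl fun η _ => ?_
    simp only [halfS]
    ring
  have e6 : ∑ ω, weight w ω * (gibbsT Γ w S T φ (setC Γ Finset.univ S ω) * ind D ω) =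
      ∑ ω, weight w ω * (condS Γ w S T φ (setC Γ Finset.univ T ω) * ind D ω) :=
    (set_sum_cond_cluster w hm S T (fun _ B => condS Γ w S T φ B) hD).symm
  have hW : withinD Γ w S T D φ h =
      (∑ ω, weight w ω * (condS Γ w S T (fun A => φ A * h A) (setC Γ Finset.univ T ω) * ind D ω)) -
        ∑ ω, weight w ω * (condS Γ w S T φ (setC Γ Finset.univ T ω) * condS Γ w S T h (setC Γ Finset.univ T ω) * ind D ω) := by
    rw [withinD, ← Finset.sum_sub_distrib]
    exact Finset.sum_congr rfl fun ω _ => by rw [condCov]; ring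
  rw [covDs, covDs, e1, e2, e3, e4, e5, e6, hW]
  ring

/-- **Telescoped form**: `cov_D(φ, h) = P(D) Σ_{k<n} R(𝑇ᵏφ) + cov_D(𝑇ⁿφ, h)`. [cite: VandenbergHaggstromKahn2005, §2.1 pp. 10–11 — corollary] -/
theorem covDs_eq_sum_withinD_add (w : V → ℝ) (hm : ∑ ω, weight w ω = 1) (S T : Set V)
    {D : Set (Set V)} (hD : ∀ ω, ω ∈ D ↔ ∀ s ∈ S, ∀ t ∈ T, t ∉ siteCluster Γ ω s)
    (φ h : Set V → ℝ) (n : ℕ) :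
    covDs Γ w S D φ h = (∑ ω, weight w ω * ind D ω) *
        ∑ k ∈ Finset.range n, withinD Γ w S T D ((gibbsT Γ w S T)^[k] φ) h +
      covDs Γ w S D ((gibbsT Γ w S T)^[n] φ) h := by
  induction n with
  | zero => simp
  | succ n ih =>
    rw [Finset.sum_range_succ, mul_add, Function.iterate_succ_apply', ih,
      covDs_eq_withinD_add w hm S T hD ((gibbsT Γ w S T)^[n] φ) h]
    ring

/-! ### Two elementary properties of `cov_D` -/

/-- `cov_D` is unchanged when a constant is subtracted from the first function. [folklore] -/
theorem covDs_sub_const (w : V → ℝ) (S : Set V) (D : Set (Set V)) (φ h : Set V → ℝ) (c : ℝ) :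
    covDs Γ w S D (fun A => φ A - c) h = covDs Γ w S D φ h := by
  have h1 : ∀ ω : Set V, weight w ω * ((φ (setC Γ Finset.univ S ω) - c) * h (setC Γ Finset.univ S ω) * ind D ω) =
      weight w ω * (φ (setC Γ Finset.univ S ω) * h (setC Γ Finset.univ S ω) * ind D ω) -
        c * (weight w ω * (h (setC Γ Finset.univ S ω) * ind D ω)) := fun ω => by ring
  have h2 : ∀ ω : Set V, weight w ω * ((φ (setC Γ Finset.univ S ω) - c) * ind D ω) =
      weight w ω * (φ (setC Γ Finset.univ S ω) * ind D ω) - c * (weight w ω * ind D ω) := fun ω => by ring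
  simp only [covDs, h1, h2, Finset.sum_sub_distrib, ← Finset.mul_sum]
  ring

/-- `|E[g 1_D]| ≤ c · P(D)` when `|g| ≤ c`. [folklore] -/
theorem abs_sum_ind_le {w : V → ℝ} (hw0 : ∀ u, 0 ≤ w u) (hw1 : ∀ u, w u ≤ 1)
    (D : Set (Set V)) {g : Set V → ℝ} {c : ℝ} (hg : ∀ ω, |g ω| ≤ c) :
    |∑ ω, weight w ω * (g ω * ind D ω)| ≤ c * ∑ ω, weight w ω * ind D ω := by
  calc |∑ ω, weight w ω * (g ω * ind D ω)| ≤ ∑ ω, |weight w ω * (g ω * ind D ω)| :=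
        Finset.abs_sum_le_sum_abs _ _
    _ ≤ ∑ ω, c * (weight w ω * ind D ω) := Finset.sum_le_sum fun ω _ => by
        rw [abs_mul, abs_mul, abs_of_nonneg (weight_nonneg hw0 hw1 ω), abs_of_nonneg (ind_nonneg D ω)]
        calc weight w ω * (|g ω| * ind D ω) ≤ weight w ω * (c * ind D ω) :=
              mul_le_mul_of_nonneg_left (mul_le_mul_of_nonneg_right (hg ω) (ind_nonneg D ω))
                (weight_nonneg hw0 hw1 ω)
          _ = c * (weight w ω * ind D ω) := by ring
    _ = c * ∑ ω, weight w ω * ind D ω := by rw [Finset.mul_sum]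

/-- **Small oscillation ⟹ small covariance**: if `φ A − φ A' ≤ δ` for all `A, A'` and `|h| ≤ M`, then `|cov_D(φ, h)| ≤ 2 δ M`. [folklore] -/
theorem abs_covDs_le {w : V → ℝ} (hw0 : ∀ u, 0 ≤ w u) (hw1 : ∀ u, w u ≤ 1)
    (hm : ∑ ω, weight w ω = 1) (S : Set V) (D : Set (Set V)) {φ h : Set V → ℝ}
    {δ M : ℝ} (hφ : ∀ A A', φ A - φ A' ≤ δ) (hM : ∀ A, |h A| ≤ M) :
    |covDs Γ w S D φ h| ≤ 2 * δ * M := by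
  have hδ : 0 ≤ δ := by simpa using hφ ∅ ∅
  have hM0 : 0 ≤ M := (abs_nonneg _).trans (hM ∅)
  set mD : ℝ := ∑ ω, weight w ω * ind D ω with hmD
  have hmD0 : 0 ≤ mD := Finset.sum_nonneg fun ω _ => mul_nonneg (weight_nonneg hw0 hw1 ω) (ind_nonneg D ω)
  have hmD1 : mD ≤ 1 := by
    calc mD ≤ ∑ ω, weight w ω := Finset.sum_le_sum fun ω _ => by
            simpa using mul_le_mul_of_nonneg_left (ind_le_one D ω) (weight_nonneg hw0 hw1 ω)
      _ = 1 := hm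
  rw [← covDs_sub_const w S D φ h (φ ∅)]
  set ψ : Set V → ℝ := fun A => φ A - φ ∅ with hψ
  have hψb : ∀ A, |ψ A| ≤ δ := fun A => abs_sub_le_iff.2 ⟨hφ A ∅, by linarith [hφ ∅ A]⟩
  have b1 : |∑ ω, weight w ω * (ψ (setC Γ Finset.univ S ω) * h (setC Γ Finset.univ S ω) * ind D ω)| ≤ δ * M * mD := by
    have := abs_sum_ind_le hw0 hw1 D (g := fun ω => ψ (setC Γ Finset.univ S ω) * h (setC Γ Finset.univ S ω)) (c := δ * M)
      (fun ω => by rw [abs_mul]; exact mul_le_mul (hψb _) (hM _) (abs_nonneg _) hδ)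
    simpa only [hmD] using this
  have b2 : |∑ ω, weight w ω * (ψ (setC Γ Finset.univ S ω) * ind D ω)| ≤ δ * mD :=
    abs_sum_ind_le hw0 hw1 D (g := fun ω => ψ (setC Γ Finset.univ S ω)) (fun ω => hψb _)
  have b3 : |∑ ω, weight w ω * (h (setC Γ Finset.univ S ω) * ind D ω)| ≤ M * mD :=
    abs_sum_ind_le hw0 hw1 D (g := fun ω => h (setC Γ Finset.univ S ω)) (fun ω => hM _)
  have hcov : covDs Γ w S D ψ h =
      mD * (∑ ω, weight w ω * (ψ (setC Γ Finset.univ S ω) * h (setC Γ Finset.univ S ω) * ind D ω)) -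
        (∑ ω, weight w ω * (ψ (setC Γ Finset.univ S ω) * ind D ω)) *
          (∑ ω, weight w ω * (h (setC Γ Finset.univ S ω) * ind D ω)) := rfl
  rw [hcov]
  have t1 : |mD * ∑ ω, weight w ω * (ψ (setC Γ Finset.univ S ω) * h (setC Γ Finset.univ S ω) * ind D ω)| ≤ δ * M := by
    rw [abs_mul, abs_of_nonneg hmD0]
    calc mD * |∑ ω, weight w ω * (ψ (setC Γ Finset.univ S ω) * h (setC Γ Finset.univ S ω) * ind D ω)| ≤ 1 * (δ * M * mD) :=
          mul_le_mul hmD1 b1 (abs_nonneg _) zero_le_one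
      _ ≤ δ * M := by rw [one_mul]; exact mul_le_of_le_one_right (mul_nonneg hδ hM0) hmD1
  have t2 : |(∑ ω, weight w ω * (ψ (setC Γ Finset.univ S ω) * ind D ω)) *
      (∑ ω, weight w ω * (h (setC Γ Finset.univ S ω) * ind D ω))| ≤ δ * M := by
    rw [abs_mul]
    calc |∑ ω, weight w ω * (ψ (setC Γ Finset.univ S ω) * ind D ω)| *
          |∑ ω, weight w ω * (h (setC Γ Finset.univ S ω) * ind D ω)|
        ≤ (δ * mD) * (M * mD) := mul_le_mul b2 b3 (abs_nonneg _) (by positivity)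
      _ ≤ δ * M := by nlinarith [mul_nonneg hδ hM0, mul_le_one₀ hmD1 hmD0 hmD1]
  calc |mD * (∑ ω, weight w ω * (ψ (setC Γ Finset.univ S ω) * h (setC Γ Finset.univ S ω) * ind D ω)) -
        (∑ ω, weight w ω * (ψ (setC Γ Finset.univ S ω) * ind D ω)) *
          (∑ ω, weight w ω * (h (setC Γ Finset.univ S ω) * ind D ω))|
      ≤ |mD * ∑ ω, weight w ω * (ψ (setC Γ Finset.univ S ω) * h (setC Γ Finset.univ S ω) * ind D ω)| +
          |(∑ ω, weight w ω * (ψ (setC Γ Finset.univ S ω) * ind D ω)) *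
            (∑ ω, weight w ω * (h (setC Γ Finset.univ S ω) * ind D ω))| := abs_sub _ _
    _ ≤ 2 * δ * M := by linarith

/-- `regenWeight w T ≤ 1`. [folklore] -/
theorem regenWeight_le_one {w : V → ℝ} (hw0 : ∀ u, 0 ≤ w u) (hw1 : ∀ u, w u ≤ 1)
    (hm : ∑ ω, weight w ω = 1) (T : Set V) : regenWeight w T ≤ 1 := by
  calc regenWeight w T ≤ ∑ η, weight w η := Finset.sum_le_sum fun η _ => by
          simpa using mul_le_mul_of_nonneg_left (ind_le_one (regenT T) η) (weight_nonneg hw0 hw1 η)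
    _ = 1 := hm

/-! ### The reduction theorem -/

/-- **Reduction of a conditional covariance sign to the averaged one-step covariances (site).**  Vertex weights `w ∈ [0,1]` with positive
regeneration weight for `T`; `D = {S ↮ T}`; `h` ANY function of `C_S`.  If `withinD(g) ≥ 0` for every monotone nonnegative `g`, then
`covDs(f, h) ≥ 0` for every monotone `f`. [cite: VandenbergHaggstromKahn2005, §2.1 pp. 10–13 — corollary, derived here for the site model] -/
theorem covDs_nonneg_of_withinD_nonneg {w : V → ℝ} (hw0 : ∀ u, 0 ≤ w u) (hw1 : ∀ u, w u ≤ 1)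
    (hm : ∑ ω, weight w ω = 1) (S T : Set V) {D : Set (Set V)}
    (hD : ∀ ω, ω ∈ D ↔ ∀ s ∈ S, ∀ t ∈ T, t ∉ siteCluster Γ ω s)
    (hε : 0 < regenWeight w T) (h : Set V → ℝ)
    (hR : ∀ g : Set V → ℝ, Monotone g → (∀ A, 0 ≤ g A) → 0 ≤ withinD Γ w S T D g h)
    {f : Set V → ℝ} (hf : Monotone f) : 0 ≤ covDs Γ w S D f h := by
  set f₀ : Set V → ℝ := fun A => f A - f ∅ with hf₀
  have hf₀m : Monotone f₀ := fun A A' hAA' => sub_le_sub_right (hf hAA') _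
  have hf₀0 : ∀ A, 0 ≤ f₀ A := fun A => sub_nonneg.2 (hf (Set.empty_subset A))
  set c : ℝ := f Set.univ - f ∅ with hc
  have hosc : ∀ A A', f₀ A - f₀ A' ≤ c := fun A A' => by
    simp only [hf₀, hc]
    linarith [hf (Set.subset_univ A), hf (Set.empty_subset A')]
  set M : ℝ := ∑ A : Set V, |h A| with hMdef
  have hM : ∀ A, |h A| ≤ M := fun A =>
    Finset.single_le_sum (f := fun A => |h A|) (fun _ _ => abs_nonneg _) (Finset.mem_univ A)
  set mD : ℝ := ∑ ω, weight w ω * ind D ω with hmD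
  have hmD0 : 0 ≤ mD := Finset.sum_nonneg fun ω _ => mul_nonneg (weight_nonneg hw0 hw1 ω) (ind_nonneg D ω)
  set ρ : ℝ := 1 - regenWeight w T with hρ
  have hρ0 : 0 ≤ ρ := sub_nonneg.2 (regenWeight_le_one hw0 hw1 hm T)
  have hρ1 : ρ < 1 := by simp only [hρ]; linarith
  have key : ∀ n : ℕ, -(2 * (ρ ^ n * c) * M) ≤ covDs Γ w S D f₀ h := by
    intro n
    rw [covDs_eq_sum_withinD_add w hm S T hD f₀ h n]
    have h1 : 0 ≤ mD * ∑ k ∈ Finset.range n, withinD Γ w S T D ((gibbsT Γ w S T)^[k] f₀) h :=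
      mul_nonneg hmD0 (Finset.sum_nonneg fun k _ =>
        hR _ (gibbsT_iterate_mono_nonneg hw0 hw1 S T hf₀m hf₀0 k).1
          (gibbsT_iterate_mono_nonneg hw0 hw1 S T hf₀m hf₀0 k).2)
    have h2 : |covDs Γ w S D ((gibbsT Γ w S T)^[n] f₀) h| ≤ 2 * (ρ ^ n * c) * M :=
      abs_covDs_le hw0 hw1 hm S D (gibbsT_iterate_sub_le hw0 hw1 hm S T n hosc) hM
    linarith [neg_abs_le (covDs Γ w S D ((gibbsT Γ w S T)^[n] f₀) h)]
  have hlim : Filter.Tendsto (fun n : ℕ => -(2 * (ρ ^ n * c) * M)) Filter.atTop (nhds 0) := by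
    have h0 : Filter.Tendsto (fun n : ℕ => ρ ^ n) Filter.atTop (nhds 0) :=
      tendsto_pow_atTop_nhds_zero_of_lt_one hρ0 hρ1
    have : Filter.Tendsto (fun n : ℕ => -(2 * (ρ ^ n * c) * M)) Filter.atTop
        (nhds (-(2 * (0 * c) * M))) :=
      (((h0.mul_const c).const_mul 2).mul_const M).neg
    simpa using this
  have hge : 0 ≤ covDs Γ w S D f₀ h := le_of_tendsto' hlim key
  rwa [hf₀, covDs_sub_const] at hge

end SiteGibbs

end Summit.CriticalPhenomena.PercolationContinuityZ3.Theorems.Transplant
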